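import Summits.AtomisticToContinuum.Crystallization.Theorems.ChartedZeroExcessLayeredLatticeLiouvilleZZZYRCXRA

/-!
# ChartedZeroExcessLayeredLatticeLiouville · ZZZYRCXRT — THE θ⁰ OUT-OF-WINDOW KERNEL: THE ASSEMBLY INTO LENS-2's `KernelSlabSoundOut` (§12)
(decomp-a2c hand-1 g55; target stmt-AtomisticToContinuum-26636 JS-D near reader, line (D) 5c θ_out; critic r1873 (B) / r1875 (B) «decode/assembly INTO
`KernelSlabSoundOut`/`kernelSlabSoundF_of_in_out`»; lens-2 RCZU §2–§3)

The out data of a window type `win` (`|win| = 2H₀ + 1`; kernel run with `wlo = 600`, `whi = 600 + 2H₀`, `amX = 600 + H₀`) is a family of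
Δm-BLOCKS indexed by the shifted far layer `ym ∈ yms` (out of the window, `|ym − 600 − H₀| ≤ M`), each ONE accepted out-slab on the whole near
window `(lo, hi]` with its decided side conditions.  §12: `outData`/`outTR`/`outTN` (decoded data, summed integer tables at `codeKO k`), the
decided checks `nonemptyAll`, `coverO H₀ M yms` (every out layer within `M` of the centre is a block), `n9F_centre`, `siteN_shift`,
`thetaG_outData_le` and ★★★ `kernelSlabSoundOut_of_blocks`: validity (RCXRA `slab_validO` + `farLayer` + `nodesWithin H₀ R`), distinctness
(strict far codes within a block, distinct far layers across blocks), COMPLETENESS for every centre-based out pair in range under ANY letter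
sequence agreeing with the window (RCXRC `outBlock_complete` + the box lemma for the far layer), and the guarded table majorants (RCXRA) —
i.e. lens-2's `KernelSlabSoundOut H₀ R (wordZ win) lo hi P9 E (outData H₀ yms cs) (outTR yms T) (outTN yms T)` VERBATIM; with RCXRI's
`kernelSlabSoundIn_of_window` and RCZU's `kernelSlabSoundF_of_in_out` the window type's K-file concludes `KernelSlabSoundF`.
Imports RCXRA; 0 sorry.  All `[folklore]`.
-/

namespace Summit.AtomisticToContinuum.Crystallization.Theorems.ChartedZeroExcessLayeredLatticeLiouville.ThetaKernel

open scoped BigOperators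

/-! ## §12 the out assembly -/

/-- decoded out data: the chords of every Δm-block `ym ∈ yms`, decoded from the centre `H₀`. -/
def outData (H₀ : ℕ) (yms : List ℕ) (cs : ℕ → List (List ℕ)) : List ChordDatum :=
  yms.flatMap fun ym => (cs ym).map (decodeChord H₀)

/-- the summed integer R table of the out blocks at the raw key `k` (window currency `codeKO`). -/
def outTR (yms : List ℕ) (T : ℕ → List (ℕ × ℕ × ℕ)) (k : ℤ × ℤ × ℤ × ℤ) : ℤ := (yms.map fun ym => (tabR (T ym) (codeKO k) : ℤ)).sum

/-- the summed integer N table of the out blocks at the raw key `k`. -/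
def outTN (yms : List ℕ) (T : ℕ → List (ℕ × ℕ × ℕ)) (k : ℤ × ℤ × ℤ × ℤ) : ℤ := (yms.map fun ym => (tabN (T ym) (codeKO k) : ℤ)).sum

/-- DECIDED: every chord of the slab has at least one code. -/
def nonemptyAll (cs : List (List ℕ)) : Bool := cs.all fun c => !c.isEmpty

/-- soundness of `nonemptyAll`. [folklore] -/
theorem ne_nil_of_nonemptyAll {cs : List (List ℕ)} (h : nonemptyAll cs = true) : ∀ c ∈ cs, c ≠ [] := by
  intro c hc
  unfold nonemptyAll at h
  have := List.all_eq_true.mp h c hc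
  cases c with
  | nil => simp at this
  | cons _ _ => exact List.cons_ne_nil _ _

/-- DECIDED COVERAGE: every shifted layer `ym` with `|ym − (600 + H₀)| ≤ M` is in the window `[600, 600 + 2H₀]` or is a block of `yms`. -/
def coverO (H₀ M : ℕ) (yms : List ℕ) : Bool :=
  (List.range (2 * M + 1)).all fun i => inWin 600 (600 + 2 * H₀) (600 + H₀ + i - M) || yms.elem (600 + H₀ + i - M)

/-- soundness of `coverO`. [folklore] -/
theorem mem_of_coverO {H₀ M : ℕ} {yms : List ℕ} (h : coverO H₀ M yms = true) (hM : M ≤ 600 + H₀) {ym : ℕ} (h1 : 600 + H₀ ≤ ym + M)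
    (h2 : ym ≤ 600 + H₀ + M) (hout : inWin 600 (600 + 2 * H₀) ym = false) : ym ∈ yms := by
  unfold coverO at h
  have hi := List.all_eq_true.mp h (ym + M - (600 + H₀)) (List.mem_range.mpr (by omega))
  have he : 600 + H₀ + (ym + M - (600 + H₀)) - M = ym := by omega
  rw [he, hout, Bool.false_or] at hi
  exact List.elem_iff.mp hi

/-- `n9F` of a centre-based pair, expanded. [folklore] -/
theorem n9F_centre (ℓ : ℤ → ℤ) (H₀ : ℕ) (y : Cell 2 × ℤ) :
    n9F ℓ (((0 : Cell 2), (H₀ : ℤ)), y) =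
      (3 * y.1 0 + (ℓ y.2 - ℓ H₀)) * (3 * y.1 0 + (ℓ y.2 - ℓ H₀)) + (3 * y.1 0 + (ℓ y.2 - ℓ H₀)) * (3 * y.1 1 + (ℓ y.2 - ℓ H₀)) +
        (3 * y.1 1 + (ℓ y.2 - ℓ H₀)) * (3 * y.1 1 + (ℓ y.2 - ℓ H₀)) + 6 * (y.2 - H₀) * (y.2 - H₀) := by
  simp only [n9F, refF0, refF1, Pi.zero_apply]
  ring

/-- an in-box site is the decoded site of its shifted ℕ coordinates. [folklore] -/
theorem siteN_shift {y : Cell 2 × ℤ} (h0 : -600 ≤ y.1 0) (h1 : -600 ≤ y.1 1) (hm : -600 ≤ y.2) :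
    siteN ((y.1 0 + 600).toNat, (y.1 1 + 600).toNat, (y.2 + 600).toNat) = y := by
  obtain ⟨γ, m⟩ := y
  simp only at h0 h1 hm
  simp only [siteN, Prod.mk.injEq]
  refine ⟨?_, by omega⟩
  funext i
  fin_cases i
  · simp only [Fin.zero_eta, Matrix.cons_val_zero]; omega
  · simp only [Fin.mk_one, Matrix.cons_val_one, Matrix.cons_val_zero]; omega

/-- the window test fails exactly off `[wlo, whi]`. [folklore] -/
theorem inWin_false_iff {wlo whi am : ℕ} : inWin wlo whi am = false ↔ ¬ (wlo ≤ am ∧ am ≤ whi) := by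
  unfold inWin
  constructor
  · intro h hh
    have h' : (Nat.ble wlo am && Nat.ble am whi) = true := by rw [Bool.and_eq_true, Nat.ble_eq, Nat.ble_eq]; exact hh
    rw [h] at h'
    exact Bool.false_ne_true h'
  · intro h
    cases hb : (Nat.ble wlo am && Nat.ble am whi)
    · rfl
    · rw [Bool.and_eq_true, Nat.ble_eq, Nat.ble_eq] at hb; exact absurd hb h

section Blocks

variable {win : List ℕ} {H₀ R P9 E GB M lo hi : ℕ} {yms : List ℕ} {t0 : ℕ → PT} {cs : ℕ → List (List ℕ)}
  {T : ℕ → List (ℕ × ℕ × ℕ)} {ℓ : ℤ → ℤ}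

/-- the guarded tables of the out data are dominated block by block. [folklore] -/
theorem thetaG_outData_le (hℓ : IsLetterSeq ℓ) (hwl : win.length = 2 * H₀ + 1) (hag : AgreesOnWindow H₀ (wordZ win) ℓ) (hH : H₀ < 601)
    (hP9 : P9 ≤ 2000000)
    (hblk : ∀ ym ∈ yms, slabAccO win 600 (600 + 2 * H₀) (600 + H₀) P9 E (lo : ℤ) (hi : ℤ) (t0 ym) (cs ym) = some (T ym) ∧
      nonemptyAll (cs ym) = true) :
    ∀ (l : List ℕ), (∀ ym ∈ l, ym ∈ yms) → ∀ k,
      thetaR0G ℓ lo hi (outData H₀ l cs) k ≤ (outTR l T k : ℝ) / 2 ^ E ∧ thetaN0G ℓ lo hi (outData H₀ l cs) k ≤ (outTN l T k : ℝ) / 2 ^ E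
  | [], _, k => by simp [outData, outTR, outTN, thetaR0G, thetaN0G]
  | ym :: rest, hl, k => by
    have hym := hblk ym (hl ym (List.mem_cons_self))
    have hne := ne_nil_of_nonemptyAll hym.2
    obtain ⟨ihR, ihN⟩ := thetaG_outData_le hℓ hwl hag hH hP9 hblk rest (fun y hy => hl y (List.mem_cons_of_mem _ hy)) k
    have hsplit : outData H₀ (ym :: rest) cs = (cs ym).map (decodeChord H₀) ++ outData H₀ rest cs := by
      simp [outData, List.flatMap_cons]
    obtain ⟨eR, eN⟩ := thetaG_append ℓ lo hi ((cs ym).map (decodeChord H₀)) (outData H₀ rest cs) k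
    have hR := slab_thetaR0G_le hℓ hwl hag hH hP9 (by positivity) hne hym.1 k
    have hN := slab_thetaN0G_le hℓ hwl hag hH hP9 (by positivity) hne hym.1 k
    rw [hsplit, eR, eN]
    simp only [outTR, outTN, List.map_cons, List.sum_cons, Int.cast_add, Int.cast_natCast] at ihR ihN ⊢
    rw [add_div, add_div]
    exact ⟨add_le_add hR ihR, add_le_add hN ihN⟩

/-- ★★★ THE OUT ASSEMBLY (lens-2 RCZU `KernelSlabSoundOut`, VERBATIM).  Window letters `win` (`|win| = 2H₀ + 1`), path radius `R`, near
window `(lo, hi]` with the box side conditions `4·hi < 3(3GB+1)²`, `hi < 6(M+1)²`; blocks `ym ∈ yms` (distinct), each: out of the letter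
window, an ACCEPTED out-slab on `(lo, hi]`, strictly increasing far codes, exactly `countWinsO … ym` chords, far layer `ym`, every node
within `R` of the centre, nonempty chords; and the decided coverage `coverO H₀ M yms`.  Conclusion: for EVERY letter sequence agreeing with
the window — validity, distinctness, completeness for centre-based out pairs in range, and the guarded table majorants. [folklore] -/
theorem kernelSlabSoundOut_of_blocks (hw2 : ∀ n ∈ win, n ≤ 2) (hwl : win.length = 2 * H₀ + 1) (hP9 : P9 ≤ 2000000) (hHM : H₀ + M ≤ 600)
    (hGB6 : GB ≤ 600) (hGB : 4 * hi < 3 * (3 * GB + 1) ^ 2) (hMb : hi < 6 * (M + 1) ^ 2) (hnd : yms.Nodup) (hcov : coverO H₀ M yms = true)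
    (hblk : ∀ ym ∈ yms, inWin 600 (600 + 2 * H₀) ym = false ∧
      slabAccO win 600 (600 + 2 * H₀) (600 + H₀) P9 E (lo : ℤ) (hi : ℤ) (t0 ym) (cs ym) = some (T ym) ∧
      lastCodesStrict (cs ym) = true ∧ (cs ym).length = countWinsO win 600 (600 + 2 * H₀) (600 + H₀) GB lo hi ym ∧
      farLayer ym (cs ym) = true ∧ nodesWithin H₀ R (cs ym) = true ∧ nonemptyAll (cs ym) = true) :
    KernelSlabSoundOut H₀ R (wordZ win) lo hi P9 E (outData H₀ yms cs) (outTR yms T) (outTN yms T) := by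
  intro ℓ hℓ hag
  have hH : H₀ < 601 := by omega
  have hρ := admO_rhoOf hℓ hwl hag
  have hGBz : 4 * (hi : ℤ) < 3 * (3 * (GB : ℤ) + 1) ^ 2 := by exact_mod_cast hGB
  have hMBz : (hi : ℤ) < 6 * ((M : ℤ) + 1) ^ 2 := by exact_mod_cast hMb
  have hmem : ∀ c' ∈ outData H₀ yms cs, ∃ ym ∈ yms, ∃ c ∈ cs ym, c' = decodeChord H₀ c := by
    intro c' hc'
    unfold outData at hc'
    obtain ⟨ym, hym, hc'⟩ := List.mem_flatMap.mp hc'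
    obtain ⟨c, hc, rfl⟩ := List.mem_map.mp hc'
    exact ⟨ym, hym, c, hc, rfl⟩
  have hfar : ∀ ym ∈ yms, ∀ c ∈ cs ym, (decodeChord H₀ c).1.2.2 = (ym : ℤ) - 600 := by
    intro ym hym c hc
    have h := farLayer_sound (hblk ym hym).2.2.2.2.1 c hc
    have hY : (decodeChord H₀ c).1.2.2 = ((lastD c 0 % 1201 : ℕ) : ℤ) - 600 := rfl
    rw [hY, h]
  refine ⟨fun c' hc' => ?_, ?_, fun x hxb hxo hxlo hxhi => ?_, fun k => ?_⟩
  · -- validity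
    obtain ⟨ym, hym, c, hc, rfl⟩ := hmem c' hc'
    obtain ⟨hout, hacc, -, -, hfl, hnw, hna⟩ := hblk ym hym
    have hne := ne_nil_of_nonemptyAll hna
    obtain ⟨hcb, hpc⟩ := slab_validO hℓ hwl hag hH hne hacc (decodeChord H₀ c) (List.mem_map.mpr ⟨c, hc, rfl⟩)
    refine ⟨hcb, ?_, piecesWithin_of_nodesWithin hne hnw c hc, hpc⟩
    rw [hfar ym hym c hc]
    rw [inWin_false_iff] at hout
    rcases le_or_gt 0 ((ym : ℤ) - 600 - H₀) with h | h
    · rw [abs_of_nonneg h]; omega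
    · rw [abs_of_neg h]; omega
  · -- distinctness
    unfold outData
    rw [List.map_flatMap]
    refine List.nodup_flatMap.mpr ⟨fun ym hym => ?_, ?_⟩
    · have hs := slab_nodup (mX := H₀) (hblk ym hym).2.2.1
      simpa [List.map_map] using hs
    · refine List.Pairwise.imp_of_mem (R := (· ≠ ·)) ?_ hnd
      intro ym ym' hym hym' hne q hq hq'
      simp only at hq hq'
      obtain ⟨c', hc', hcq⟩ := List.mem_map.mp hq
      obtain ⟨c'', hc'', hcq'⟩ := List.mem_map.mp hq'
      obtain ⟨d, hd, rfl⟩ := List.mem_map.mp hc'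
      obtain ⟨d', hd', rfl⟩ := List.mem_map.mp hc''
      have h1 := hfar ym hym d hd
      have h2 := hfar ym' hym' d' hd'
      rw [hcq] at h1
      rw [hcq'] at h2
      exact hne (by exact_mod_cast (show (ym : ℤ) = ym' by linarith))
  · -- completeness
    obtain ⟨⟨γX, mX⟩, y⟩ := x
    obtain ⟨hγ, hm⟩ := hxb
    simp only at hγ hm hxo hxlo hxhi
    subst hγ; subst hm
    have hℓy := hℓ y.2
    have hℓc := hℓ (H₀ : ℤ)
    have hd : |ℓ y.2 - ℓ H₀| ≤ 2 := by rw [abs_le]; omega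
    rw [n9F_centre] at hxlo hxhi
    obtain ⟨hg0, hg1, hgm⟩ := inBox_of_n9_le (y.1 0) (y.1 1) (y.2 - H₀) _ (hi : ℤ) GB M hd hxhi hGBz hMBz
    rw [abs_le] at hg0 hg1 hgm
    set y0 := (y.1 0 + 600).toNat with hy0
    set y1 := (y.1 1 + 600).toNat with hy1
    set ym := (y.2 + 600).toNat with hym
    have e0 : (y0 : ℤ) = y.1 0 + 600 := by rw [hy0]; omega
    have e1 : (y1 : ℤ) = y.1 1 + 600 := by rw [hy1]; omega
    have em : (ym : ℤ) = y.2 + 600 := by rw [hym]; omega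
    have hsite : siteN (y0, y1, ym) = y := siteN_shift (by omega) (by omega) (by omega)
    have hlift : liftN (chordX H₀, (y0, y1, ym)) = (((0 : Cell 2), (H₀ : ℤ)), y) := by rw [liftN, siteN_chordX, hsite]
    have hout : inWin 600 (600 + 2 * H₀) ym = false := by
      refine inWin_false_iff.mpr fun hcon => ?_
      have : |y.2 - (H₀ : ℤ)| ≤ H₀ := by rw [abs_le]; omega
      exact absurd hxo (not_lt.mpr this)
    have hymem : ym ∈ yms := mem_of_coverO hcov (by omega) (by omega) (by omega) hout
    obtain ⟨-, hacc, hstrict, hcount, hfl, -, -⟩ := hblk ym hymem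
    have hform : n9F ℓ (((0 : Cell 2), (H₀ : ℤ)), y) = n9Z (vecL (rhoOf ℓ) (chordXO (600 + H₀), (y0, y1, ym))) := by
      rw [chordXO_eq, ← hlift, n9F_liftN_rho hℓ]
    rw [← n9F_centre, hform] at hxlo hxhi
    obtain ⟨c, hc, hdec⟩ := outBlock_complete hw2 (inWin_base H₀) (by omega) hGBz hacc hstrict hfl hcount hρ hxlo hxhi
    refine ⟨decodeChord H₀ c, ?_, ?_⟩
    · unfold outData
      exact List.mem_flatMap.mpr ⟨ym, hymem, List.mem_map.mpr ⟨c, hc, rfl⟩⟩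
    · rw [decodeChord_fst, hdec, hlift]
  · -- tables
    exact thetaG_outData_le hℓ hwl hag hH hP9 (fun ym hym => ⟨(hblk ym hym).2.1, (hblk ym hym).2.2.2.2.2.2⟩) yms (fun _ h => h) k

end Blocks

end Summit.AtomisticToContinuum.Crystallization.Theorems.ChartedZeroExcessLayeredLatticeLiouville.ThetaKernel
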